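/-
Origin: expansion seat `prover-pub-hodgecm-mc-carch-1-g4-0`, handover #CA49 2026-08-20T10:45Z md5 6a10b8b6f257 (209 l., 14 decls; NEW additive leaf; imports #CA48 (this kit) + installed RUN-45 #CA33 Model.ArchKTypeOfLineTables + installed RUN-48 #CA41 Model.ArchKTypeOfSlotRecChar34; RUN 49; INSTALL after #CA48; cert certs/ax-ArchKTypeOfLineTables34-6a10b8b6f257.log: rc 0 / 43 s / 0 warnings / trio) (`HOME/mc/pub-hodgecm-mc-carch-1/pkg49/HodgeCM/Model/ArchKTypeOfLineTables34.lean`, md5 6a10b8b6f257, 209 lines);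
landed by the gen-19 packager (p-g19) in gate run 49 as `HodgeCM/Model/ArchKTypeOfLineTables34.lean` (verbatim).
-/
/-
Copyright (c) 2026. Released under Apache 2.0 license as described in the file LICENSE.
Cell pub-hodgecm, MODEL layer (construction prover mc-carch-1, gen 4), BINDER-OWNERS row 12 `C`, junction (C-Λ) § 5 for the
CONJUGATED plane: the read-off tables of lines 2, 3 (pin R2) — the (34) twin of RUN-45 #CA33 `ArchKTypeOfLineTables`, §§ 1–3 + sockets.
-/
import Summits.HodgeConjecture.HodgeCM.Model.ArchKTypeOfLambdaDef34
import Summits.HodgeConjecture.HodgeCM.Model.ArchKTypeOfLineTables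
import Summits.HodgeConjecture.HodgeCM.Model.ArchKTypeOfSlotRecChar34

/-!
# (C-Λ)′ § 5: the line tables of the conjugated plane and the (c5)₂/(c5)₃ read-off sockets

For lines `k = 2, 3` (`d₂ = dW' c.D 0`, `d₃ = dW' c.D 1`, splittings `hGR₂/hGR₃`, positivity `hpos₂/hpos₃` = sinst `hpos_GOG … .2.2`):

* § 1 the `det`-power tables of record `defExponentTwo V c hGR₂ hpos₂`, `defExponentThree V c hGR₃ hpos₃ : {v real} → ℤ` (one
  `Classical.choose` each of #CA20 `exists_defExponent_blockFamilyOfAt`) with `_spec` (= the `hω` hypotheses of #CA44);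
* § 2 `cmConjLineChar₁_apply_mk_one`, `eta₃_apply_mk_one` (no `V`-parts), hence `archScalar_threeG_archSingle_eq` (the line-3 scalar on a
  one-place element is the `η₃`-value alone);
* § 3 **the type table of the second twist `ν′` (pin R2)**: `n₃R (mk ι₁) := −eP³`, `n₃R (w b) := −a₃(b)` (`b ≠ v₁`), and the VALUE the fixed
  `χVR` must take on line 2: `nVR₂ (mk ι₁) := −eP² − eP³ − ℓ′`, `nVR₂ (w b) := −a₂(b) − a₃(b) − ℓ′_b` — R2 is consistent iff `nVR = nVR₂`
  (the (C-Σ)/(C-Σ)′ see-saw identities: both sides are `−pairVacExponent` off `v₁`, #CA36 and its conj twin);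
* § 4 sockets: **`hdef_three_of_eta`** (if `η₃((archSingle u)^𝔸, 1) = det(u)^{−a₃ b}` then the `hdef` input of #CA44 `harch_three_of_defType(_coset)G`
  holds) — with #CA48 `hdef_two_of_archType` this is what an R2 pin `(…, etaT₂ η ν′, etaT₃ η ν′)` discharges by the #CA33 § 4 argument.

0 records, 0 `def … : Prop`, nothing cited as a hypothesis.
-/

set_option autoImplicit false

noncomputable section

open NumberField NumberField.InfinitePlace NumberField.mixedEmbedding IsDedekindDomain
open scoped Matrix Classical
open ComplexConjugate
open Literature.NumberTheory.Automorphic Literature.NumberTheory.Automorphic.UnitaryGroup Literature.NumberTheory.Weil1964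
open Literature.NumberTheory.GelbartRogawski1991 Literature.NumberTheory.GelbartRogawski1991.UnitaryDualPair
open Literature.RepresentationTheory.KonnoKonno2007
open Literature.Analysis.SegalBargmann
open HodgeCM.Adelic HodgeCM.PerL34 HodgeCM.Model.HypCensus HodgeCM.Model.ArchSideTerm

namespace HodgeCM.Model

section Tables34

variable {L : CMField} {ι₁ : L →+* ℂ} (V : HermSpace3 L ι₁) (c : SeesawCtx L)
variable
  (hGR : (cmSplittingDatum (L : Type) finProdFinEquiv (frameD V) (frameD_real V) (frameD_ne V) (dW c.D) (dW_real c.D) (dW_ne c.D)).CompatibleSplitting)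
  (hGR₂ : (cmSplittingDatum (L : Type) (e₁) (frameD V) (frameD_real V) (frameD_ne V) (lineVec (L : Type) (dW' c.D 0))
    (fun _ => dW'_real c.D 0) (fun _ => dW'_ne c.D 0)).CompatibleSplitting)
  (hGR₃ : (cmSplittingDatum (L : Type) (e₁) (frameD V) (frameD_real V) (frameD_ne V) (lineVec (L : Type) (dW' c.D 1))
    (fun _ => dW'_real c.D 1) (fun _ => dW'_ne c.D 1)).CompatibleSplitting)
  (h₁W : (∀ j, 0 < (ι₁ (dW c.D j)).re) ∨ ∀ j, (ι₁ (dW c.D j)).re < 0)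
  (hpos₂ : 0 < cmXW (L : Type) (frameD V) (lineVec (L : Type) (dW' c.D 0)) (fun _ => dW'_real c.D 0) ι₁ (HypCensus.cmPlace (L : Type) ι₁) 0)
  (hpos₃ : 0 < cmXW (L : Type) (frameD V) (lineVec (L : Type) (dW' c.D 1)) (fun _ => dW'_real c.D 1) ι₁ (HypCensus.cmPlace (L : Type) ι₁) 0)

/-! ## § 1 The exponents of record at the definite places -/

/-- **`a₂ : {v real} → ℤ`, the `det`-power table OF RECORD of line 2** (one `Classical.choose` of #CA20 `exists_defExponent_blockFamilyOfAt`). -/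
def defExponentTwo : {v : InfinitePlace ↥(maximalRealSubfield L) // v.IsReal} → ℤ :=
  (exists_defExponent_blockFamilyOfAt Empty V (dW' c.D 0) (dW'_real c.D 0) (dW'_ne c.D 0) hGR₂ (posIdxEquivUnit hpos₂) (negIdxEquivEmpty hpos₂)).choose

/-- its defining property (= the `hω` hypothesis of #CA44 `harch_two_of_defTypeG`). -/
theorem defExponentTwo_spec :
    ∀ b : {v : InfinitePlace ↥(maximalRealSubfield L) // v.IsReal}, b ≠ HypCensus.cmPlace (L : Type) ι₁ →
      ∀ (u : archLocal (L : Type) 3 (Matrix.diagonal (frameD V)) (cmPlaceOver (L : Type) b)) (ℓ : Module.Dual ℂ (Fin 2 → ℂ)),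
        cmArchWeilRep (L : Type) e₁ (frameD V) (frameD_real V) (frameD_ne V) (lineVec (L : Type) (dW' c.D 0)) (fun _ => dW'_real c.D 0)
            (fun _ => dW'_ne c.D 0) hGR₂
            (UnitaryGroup.archSingle (↥(maximalRealSubfield L)) L (IsCMField.complexConj L) 3 (Matrix.diagonal (frameD V))
              (IsCMField.complexConj_ne_one L) (UnitaryGroup.complexConj_smul_infinitePlace (L : Type)) (cmPlaceOver (L : Type) b) u, 1)
            (blockFamilyOfAt (L : Type) e₁ (frameD V) (frameD_real V) (frameD_ne V) (lineVec (L : Type) (dW' c.D 0)) (fun _ => dW'_real c.D 0)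
              (fun _ => dW'_ne c.D 0) ι₁ (blockPosEquiv V) (blockNegEquiv V) (posIdxEquivUnit hpos₂) (negIdxEquivEmpty hpos₂) (degOnePDual Empty)
              (binvPi 1) ℓ) =
          (((u : archLocal (L : Type) 3 (Matrix.diagonal (frameD V)) (cmPlaceOver (L : Type) b)) : GL (Fin 3) ℂ) :
              Matrix (Fin 3) (Fin 3) ℂ).det ^ defExponentTwo V c hGR₂ hpos₂ b •
            blockFamilyOfAt (L : Type) e₁ (frameD V) (frameD_real V) (frameD_ne V) (lineVec (L : Type) (dW' c.D 0)) (fun _ => dW'_real c.D 0)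
              (fun _ => dW'_ne c.D 0) ι₁ (blockPosEquiv V) (blockNegEquiv V) (posIdxEquivUnit hpos₂) (negIdxEquivEmpty hpos₂) (degOnePDual Empty)
              (binvPi 1) ℓ :=
  (exists_defExponent_blockFamilyOfAt Empty V (dW' c.D 0) (dW'_real c.D 0) (dW'_ne c.D 0) hGR₂ (posIdxEquivUnit hpos₂) (negIdxEquivEmpty hpos₂)).choose_spec

/-- **`a₃`, the `det`-power table OF RECORD of line 3.** -/
def defExponentThree : {v : InfinitePlace ↥(maximalRealSubfield L) // v.IsReal} → ℤ :=
  (exists_defExponent_blockFamilyOfAt Empty V (dW' c.D 1) (dW'_real c.D 1) (dW'_ne c.D 1) hGR₃ (posIdxEquivUnit hpos₃) (negIdxEquivEmpty hpos₃)).choose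

/-- its defining property (= the `hω` hypothesis of #CA44 `harch_three_of_defTypeG`). -/
theorem defExponentThree_spec :
    ∀ b : {v : InfinitePlace ↥(maximalRealSubfield L) // v.IsReal}, b ≠ HypCensus.cmPlace (L : Type) ι₁ →
      ∀ (u : archLocal (L : Type) 3 (Matrix.diagonal (frameD V)) (cmPlaceOver (L : Type) b)) (ℓ : Module.Dual ℂ (Fin 2 → ℂ)),
        cmArchWeilRep (L : Type) e₁ (frameD V) (frameD_real V) (frameD_ne V) (lineVec (L : Type) (dW' c.D 1)) (fun _ => dW'_real c.D 1)
            (fun _ => dW'_ne c.D 1) hGR₃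
            (UnitaryGroup.archSingle (↥(maximalRealSubfield L)) L (IsCMField.complexConj L) 3 (Matrix.diagonal (frameD V))
              (IsCMField.complexConj_ne_one L) (UnitaryGroup.complexConj_smul_infinitePlace (L : Type)) (cmPlaceOver (L : Type) b) u, 1)
            (blockFamilyOfAt (L : Type) e₁ (frameD V) (frameD_real V) (frameD_ne V) (lineVec (L : Type) (dW' c.D 1)) (fun _ => dW'_real c.D 1)
              (fun _ => dW'_ne c.D 1) ι₁ (blockPosEquiv V) (blockNegEquiv V) (posIdxEquivUnit hpos₃) (negIdxEquivEmpty hpos₃) (degOnePDual Empty)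
              (binvPi 1) ℓ) =
          (((u : archLocal (L : Type) 3 (Matrix.diagonal (frameD V)) (cmPlaceOver (L : Type) b)) : GL (Fin 3) ℂ) :
              Matrix (Fin 3) (Fin 3) ℂ).det ^ defExponentThree V c hGR₃ hpos₃ b •
            blockFamilyOfAt (L : Type) e₁ (frameD V) (frameD_real V) (frameD_ne V) (lineVec (L : Type) (dW' c.D 1)) (fun _ => dW'_real c.D 1)
              (fun _ => dW'_ne c.D 1) ι₁ (blockPosEquiv V) (blockNegEquiv V) (posIdxEquivUnit hpos₃) (negIdxEquivEmpty hpos₃) (degOnePDual Empty)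
              (binvPi 1) ℓ :=
  (exists_defExponent_blockFamilyOfAt Empty V (dW' c.D 1) (dW'_real c.D 1) (dW'_ne c.D 1) hGR₃ (posIdxEquivUnit hpos₃) (negIdxEquivEmpty hpos₃)).choose_spec

/-! ## § 2 No `V`-parts on line 3 -/

/-- **`χ₃′(x, 1) = 1`**: K-1's conj line-1 see-saw character `cmConjLineChar₁ = char₄ ∘ snd` has no `V`-part. -/
theorem cmConjLineChar₁_apply_mk_one (x : CMAdelic (L : Type) (frameD V)) :
    cmConjLineChar₁ (L : Type) finProdFinEquiv e₁ (frameD V) (frameD_real V) (frameD_ne V) (dW c.D) (dW_real c.D) (dW_ne c.D) (dW' c.D)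
      (dW'_real c.D) (dW'_ne c.D) c.D.isoGL (isoGL_hg₀ c.D) hGR hGR₂ hGR₃ (x, 1) = 1 := by
  unfold cmConjLineChar₁
  simp

/-- **`η₃(x, 1) = 1`** for the S pin's conj line-1 twist `eta₃ V S η = cmConjEta₁ η ∘ snd`. -/
theorem eta₃_apply_mk_one (η : CMAdelic (L : Type) (frameD V) × CMAdelic (L : Type) (dW c.D) →* ℂˣ) (x : CMAdelic (L : Type) (frameD V)) :
    eta₃ V c.D η (x, 1) = 1 := by
  unfold eta₃
  simp

/-- **the line-3 scalar on a one-place element is its `η₃`-value** (`χ₃′` drops out). -/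
theorem archScalar_threeG_archSingle_eq (η₃ : CMAdelic (L : Type) (frameD V) × CMAdelicOne (L : Type) →* ℂˣ)
    (x : UnitaryGroup.arch (↥(maximalRealSubfield L)) L (IsCMField.complexConj L) 3 (Matrix.diagonal (frameD V))) :
    archScalar_threeG V c.D hGR hGR₂ hGR₃ η₃ x =
      η₃ (UnitaryGroup.archToAdelic (↥(maximalRealSubfield L)) L (IsCMField.complexConj L) 3 (Matrix.diagonal (frameD V)) x, 1) := by
  rw [archScalar_three_applyG, cmConjLineChar₁_apply_mk_one, mul_one]

/-! ## § 3 The tables of pin R2 -/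

/-- **the type table of the second twist `ν′` (line 3)**: `−eP³` at the place of `ι₁`, `−a₃(b)` at the complex place over a real `b ≠ v₁`. -/
def n₃R (w : InfinitePlace (L : Type)) : ℤ :=
  if placeUnder w = HypCensus.cmPlace (L : Type) ι₁ then
    -(lineVacExponentsThree V c hGR₃ (posIdxEquivUnit hpos₃) (negIdxEquivEmpty hpos₃)).eP
  else -defExponentThree V c hGR₃ hpos₃ (placeUnder w)

/-- **the value the V-type must take on line 2 at pin R2** (line 2 carries `χV · ν′⁻¹ · λ′`): `−eP² − eP³ − ℓ′` at the place of `ι₁`,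
`−a₂(b) − a₃(b) − ℓ′_b` over a real `b ≠ v₁`.  R2 is consistent iff this table equals #CA33's `nVR` (the (C-Σ)′ identities). -/
def nVR₂ (w : InfinitePlace (L : Type)) : ℤ :=
  if h : placeUnder w = HypCensus.cmPlace (L : Type) ι₁ then
    -(lineVacExponentsTwo V c hGR₂ (posIdxEquivUnit hpos₂) (negIdxEquivEmpty hpos₂)).eP
      - (lineVacExponentsThree V c hGR₃ (posIdxEquivUnit hpos₃) (negIdxEquivEmpty hpos₃)).eP
  else -defExponentTwo V c hGR₂ hpos₂ (placeUnder w) - defExponentThree V c hGR₃ hpos₃ (placeUnder w) -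
    defLambdaExponentConj V c.D hGR hGR₂ hGR₃ h₁W (placeUnder w) h

/-- (Ported verbatim from the HodgeCMPerL package; no docstring in the source.) -/
theorem n₃R_of_ne {b : {v : InfinitePlace ↥(maximalRealSubfield L) // v.IsReal}} (hb : b ≠ HypCensus.cmPlace (L : Type) ι₁) :
    n₃R V c hGR₃ hpos₃ (cmPlaceOver (L : Type) b).1 = -defExponentThree V c hGR₃ hpos₃ b := by
  rw [n₃R, placeUnder_cmPlaceOver, if_neg hb]

/-- (Ported verbatim from the HodgeCMPerL package; no docstring in the source.) -/
theorem n₃R_mk : n₃R V c hGR₃ hpos₃ (InfinitePlace.mk ι₁) =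
    -(lineVacExponentsThree V c hGR₃ (posIdxEquivUnit hpos₃) (negIdxEquivEmpty hpos₃)).eP := by
  rw [n₃R, if_pos ((placeUnder_eq_cmPlace_iff _).mpr rfl)]

/-- (Ported verbatim from the HodgeCMPerL package; no docstring in the source.) -/
theorem nVR₂_of_ne {b : {v : InfinitePlace ↥(maximalRealSubfield L) // v.IsReal}} (hb : b ≠ HypCensus.cmPlace (L : Type) ι₁) :
    nVR₂ V c hGR hGR₂ hGR₃ h₁W hpos₂ hpos₃ (cmPlaceOver (L : Type) b).1 =
      -defExponentTwo V c hGR₂ hpos₂ b - defExponentThree V c hGR₃ hpos₃ b - defLambdaExponentConj V c.D hGR hGR₂ hGR₃ h₁W b hb := by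
  unfold nVR₂
  rw [dif_neg (by rw [placeUnder_cmPlaceOver]; exact hb)]
  simp only [placeUnder_cmPlaceOver]

/-! ## § 4 The (c5)₃ / (c5)₂ read-off sockets -/

/-- **THE (c5)₃ SOCKET.**  If the line-3 twist's `V`-part on every `U(V)(L_b)`, `b ≠ v₁`, is `det(u)^{−a₃ b}` (at pin R2: `η₃ := etaT₃ η ν′`
with `ν′` of type `n₃R`, K-1 `coe_cmDetTwistChar_archSingle_one`), then the `hdef` input of #CA44 `harch_three_of_defType(_coset)G` holds
at `a := defExponentThree`. -/
theorem hdef_three_of_eta (η₃ : CMAdelic (L : Type) (frameD V) × CMAdelicOne (L : Type) →* ℂˣ)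
    (hη : ∀ b : {v : InfinitePlace ↥(maximalRealSubfield L) // v.IsReal}, b ≠ HypCensus.cmPlace (L : Type) ι₁ →
      ∀ u : UnitaryGroup.archLocal (L : Type) 3 (Matrix.diagonal (frameD V)) (cmPlaceOver (L : Type) b),
        ((η₃ (UnitaryGroup.archToAdelic (↥(maximalRealSubfield L)) L (IsCMField.complexConj L) 3 (Matrix.diagonal (frameD V))
            (UnitaryGroup.archSingle (↥(maximalRealSubfield L)) L (IsCMField.complexConj L) 3 (Matrix.diagonal (frameD V))
              (IsCMField.complexConj_ne_one L) (NumberField.complexConj_smul_infinitePlace (L : Type)) (cmPlaceOver (L : Type) b) u), 1) : ℂˣ) : ℂ) =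
          (((u : UnitaryGroup.archLocal (L : Type) 3 (Matrix.diagonal (frameD V)) (cmPlaceOver (L : Type) b)) : GL (Fin 3) ℂ) :
            Matrix (Fin 3) (Fin 3) ℂ).det ^ (-defExponentThree V c hGR₃ hpos₃ b)) :
    ∀ b : {v : InfinitePlace ↥(maximalRealSubfield L) // v.IsReal}, b ≠ HypCensus.cmPlace (L : Type) ι₁ →
      ∀ u : UnitaryGroup.archLocal (L : Type) 3 (Matrix.diagonal (frameD V)) (cmPlaceOver (L : Type) b),
        ((archScalar_threeG V c.D hGR hGR₂ hGR₃ η₃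
            (UnitaryGroup.archSingle (↥(maximalRealSubfield L)) L (IsCMField.complexConj L) 3 (Matrix.diagonal (frameD V))
              (IsCMField.complexConj_ne_one L) (NumberField.complexConj_smul_infinitePlace (L : Type)) (cmPlaceOver (L : Type) b) u) : ℂˣ) : ℂ) *
          (((u : UnitaryGroup.archLocal (L : Type) 3 (Matrix.diagonal (frameD V)) (cmPlaceOver (L : Type) b)) : GL (Fin 3) ℂ) :
              Matrix (Fin 3) (Fin 3) ℂ).det ^ defExponentThree V c hGR₃ hpos₃ b = 1 := by
  intro b hb u
  have hdet : (((u : UnitaryGroup.archLocal (L : Type) 3 (Matrix.diagonal (frameD V)) (cmPlaceOver (L : Type) b)) : GL (Fin 3) ℂ) :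
      Matrix (Fin 3) (Fin 3) ℂ).det ≠ 0 := by
    rw [← Matrix.GeneralLinearGroup.val_det_apply]
    exact Units.ne_zero _
  rw [archScalar_threeG_archSingle_eq, hη b hb u, ← zpow_add₀ hdet, neg_add_cancel, zpow_zero]

/-- **THE (c5)₂ SOCKET at pin R2** (#CA48 `hdef_two_of_archType` at `a := defExponentTwo`): the line-2 twist's `V`-part of type `m` with
`m b + ℓ′_b + a₂ b = 0` — at pin R2 `m (w b) = nVR (w b) − n₃R (w b)`, so the condition reads `nVR (w b) = nVR₂ (w b)`. -/
theorem hdef_two_of_type (η₂ : CMAdelic (L : Type) (frameD V) × CMAdelicOne (L : Type) →* ℂˣ)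
    (m : {v : InfinitePlace ↥(maximalRealSubfield L) // v.IsReal} → ℤ)
    (hη : ∀ b : {v : InfinitePlace ↥(maximalRealSubfield L) // v.IsReal}, b ≠ HypCensus.cmPlace (L : Type) ι₁ →
      ∀ u : UnitaryGroup.archLocal (L : Type) 3 (Matrix.diagonal (frameD V)) (cmPlaceOver (L : Type) b),
        ((η₂ (UnitaryGroup.archToAdelic (↥(maximalRealSubfield L)) L (IsCMField.complexConj L) 3 (Matrix.diagonal (frameD V))
            (UnitaryGroup.archSingle (↥(maximalRealSubfield L)) L (IsCMField.complexConj L) 3 (Matrix.diagonal (frameD V))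
              (IsCMField.complexConj_ne_one L) (NumberField.complexConj_smul_infinitePlace (L : Type)) (cmPlaceOver (L : Type) b) u), 1) : ℂˣ) : ℂ) =
          (((u : UnitaryGroup.archLocal (L : Type) 3 (Matrix.diagonal (frameD V)) (cmPlaceOver (L : Type) b)) : GL (Fin 3) ℂ) :
            Matrix (Fin 3) (Fin 3) ℂ).det ^ m b)
    (hm : ∀ b : {v : InfinitePlace ↥(maximalRealSubfield L) // v.IsReal}, ∀ hb : b ≠ HypCensus.cmPlace (L : Type) ι₁,
      m b + defLambdaExponentConj V c.D hGR hGR₂ hGR₃ h₁W b hb + defExponentTwo V c hGR₂ hpos₂ b = 0) :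
    ∀ b : {v : InfinitePlace ↥(maximalRealSubfield L) // v.IsReal}, b ≠ HypCensus.cmPlace (L : Type) ι₁ →
      ∀ u : UnitaryGroup.archLocal (L : Type) 3 (Matrix.diagonal (frameD V)) (cmPlaceOver (L : Type) b),
        ((archScalar_twoG V c.D hGR hGR₂ hGR₃ η₂
            (UnitaryGroup.archSingle (↥(maximalRealSubfield L)) L (IsCMField.complexConj L) 3 (Matrix.diagonal (frameD V))
              (IsCMField.complexConj_ne_one L) (NumberField.complexConj_smul_infinitePlace (L : Type)) (cmPlaceOver (L : Type) b) u) : ℂˣ) : ℂ) *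
          (((u : UnitaryGroup.archLocal (L : Type) 3 (Matrix.diagonal (frameD V)) (cmPlaceOver (L : Type) b)) : GL (Fin 3) ℂ) :
              Matrix (Fin 3) (Fin 3) ℂ).det ^ defExponentTwo V c hGR₂ hpos₂ b = 1 :=
  hdef_two_of_archType V c.D hGR hGR₂ hGR₃ η₂ h₁W (defExponentTwo V c hGR₂ hpos₂) m hη hm

end Tables34

end HodgeCM.Model

end
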